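import Summits.Ventures.PercRepro.C026ProdCFCone

/-!
# THEOREM PROD-CF for `k` generators: `K_CF` is closed under the product (p5, gen 16)

mine-3's THEOREM PROD-CF (`proofs/MINE3-PRODUCT.md` §2b) is stated for `k` generators
`g₁, …, g_k ∈ K_CF`: with `T = Π tᵢ`, `P = Π (zᵢ + pᵢ)`, `Q = Π (zᵢ + qᵢ)`, `Z = Π zᵢ`,
`Mₐ = Π (tᵢ + Aᵢ)`, `M_b = Π (tᵢ + Bᵢ)` and `N = T − P − Q + Z`, `𝒜 = Mₐ − T`, `ℬ = M_b − T`,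
`N ≤ 𝒜 + ℬ`. The two-generator inequality `ProdCF.prodCF_two'` of `C026ProdCFCone` gives it for
every `k` because **the `K_CF` conditions are closed under the coordinatewise product** in the
product coordinates `(T, P, Q, Z, Mₐ, M_b)`:

* `MemKCFProd` — the nine conditions of `prodCF_two'` on a six-tuple (`0 ≤ Z ≤ P, Q`,
  `P + Q ≤ T + Z`, `T ≤ Mₐ, M_b`, `P + T ≤ Mₐ + Z`, `Q + T ≤ M_b + Z`, `3T + Z ≤ P + Q + Mₐ + M_b`;
  the last is (CF)); `MemKCFProd.one` for the identity `(1, 1, 1, 1, 1, 1)`;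
* **`MemKCFProd.mul`** — the product of two tuples in `K_CF` is in `K_CF` (the last condition is
  `prodCF_two'`, the others are monotonicity);
* `MemKCFProd.prod` — hence the product over any finite family;
* **`prodCF_prod`** — THEOREM PROD-CF for `k` generators: `3·T + Z ≤ P + Q + Mₐ + M_b`, i.e.
  `N ≤ 𝒜 + ℬ`, for the products over a finite family of generators of `K_CF`.
-/

namespace PercRepro

namespace ProdCF

variable {K : Type*} [CommRing K] [LinearOrder K] [IsStrictOrderedRing K]

/-- **`K_CF` in the product coordinates** `(T, P, Q, Z, Mₐ, M_b) = (t, z+p, z+q, z, t+A, t+B)`: the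
nine conditions of `prodCF_two'`, the last one being (CF) itself. -/
structure MemKCFProd (T P Q Z Ma Mb : K) : Prop where
  /-- `0 ≤ Z` -/
  z_nonneg : 0 ≤ Z
  /-- `Z ≤ P` -/
  z_le_p : Z ≤ P
  /-- `Z ≤ Q` -/
  z_le_q : Z ≤ Q
  /-- `P + Q ≤ T + Z` (`0 ≤ n`) -/
  n_nonneg : P + Q ≤ T + Z
  /-- `T ≤ Mₐ` (`0 ≤ A`) -/
  t_le_ma : T ≤ Ma
  /-- `T ≤ M_b` (`0 ≤ B`) -/
  t_le_mb : T ≤ Mb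
  /-- `P + T ≤ Mₐ + Z` (`p ≤ A`) -/
  p_le_a : P + T ≤ Ma + Z
  /-- `Q + T ≤ M_b + Z` (`q ≤ B`) -/
  q_le_b : Q + T ≤ Mb + Z
  /-- `3T + Z ≤ P + Q + Mₐ + M_b` (`n ≤ A + B`, (CF)) -/
  cf : 3 * T + Z ≤ P + Q + Ma + Mb

/-- The identity `(1, 1, 1, 1, 1, 1)` (the generator `r₁ = (1, 0, 0, 0, 0, 0)`) is in `K_CF`. -/
theorem MemKCFProd.one : MemKCFProd (1 : K) 1 1 1 1 1 :=
  ⟨zero_le_one, le_rfl, le_rfl, le_rfl, le_rfl, le_rfl, le_rfl, le_rfl, by norm_num⟩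

/-- A generator of `K_CF` in product coordinates is a `MemKCF` generator. -/
theorem MemKCFProd.memKCF {T P Q Z Ma Mb : K} (h : MemKCFProd T P Q Z Ma Mb) :
    MemKCF Z (P - Z) (Q - Z) (T - P - Q + Z) (Ma - T) (Mb - T) :=
  ⟨h.z_nonneg, by linarith [h.z_le_p], by linarith [h.z_le_q], by linarith [h.n_nonneg],
    by linarith [h.t_le_ma], by linarith [h.t_le_mb], by linarith [h.p_le_a],
    by linarith [h.q_le_b], by linarith [h.cf]⟩

/-- **`K_CF` is closed under the product**: the coordinatewise product of two six-tuples of `K_CF`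
is in `K_CF`. The (CF) condition of the product is `prodCF_two'`; the others are monotonicity of
products of nonnegative quantities. -/
theorem MemKCFProd.mul {T P Q Z Ma Mb T' P' Q' Z' Ma' Mb' : K} (h : MemKCFProd T P Q Z Ma Mb)
    (h' : MemKCFProd T' P' Q' Z' Ma' Mb') :
    MemKCFProd (T * T') (P * P') (Q * Q') (Z * Z') (Ma * Ma') (Mb * Mb') := by
  obtain ⟨hz, hzp, hzq, hn, hta, htb, hpa, hqb, hcf⟩ := h
  obtain ⟨hz', hzp', hzq', hn', hta', htb', hpa', hqb', hcf'⟩ := h'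
  -- the generator coordinates of both tuples are nonnegative
  have hp : 0 ≤ P := by linarith
  have hq : 0 ≤ Q := by linarith
  have ht : 0 ≤ T := by linarith
  have hma : 0 ≤ Ma := by linarith
  have hmb : 0 ≤ Mb := by linarith
  have hp' : 0 ≤ P' := by linarith
  have hq' : 0 ≤ Q' := by linarith
  have ht' : 0 ≤ T' := by linarith
  have hma' : 0 ≤ Ma' := by linarith
  have hmb' : 0 ≤ Mb' := by linarith
  have hpt : P ≤ T := by linarith
  have hqt : Q ≤ T := by linarith
  have hpt' : P' ≤ T' := by linarith
  have hqt' : Q' ≤ T' := by linarith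
  refine ⟨mul_nonneg hz hz', mul_le_mul hzp hzp' hz' hp, mul_le_mul hzq hzq' hz' hq, ?_,
    mul_le_mul hta hta' ht' hma, mul_le_mul htb htb' ht' hmb, ?_, ?_,
    prodCF_two' hz hzp hzq hn hta htb hpa hqb hcf hz' hzp' hzq' hn' hta' htb' hpa' hqb' hcf'⟩
  · -- `0 ≤ n` for the product: `P P' + Q Q' ≤ T T' + Z Z'`
    nlinarith [mul_le_mul hpt hpt' hp' ht, mul_le_mul hqt hqt' hq' ht,
      mul_nonneg (sub_nonneg.2 hpt) (sub_nonneg.2 hzq'), mul_nonneg (sub_nonneg.2 hzq) (sub_nonneg.2 hpt'),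
      mul_nonneg (sub_nonneg.2 hn) (sub_nonneg.2 hn'), mul_nonneg (sub_nonneg.2 hn) hz',
      mul_nonneg hz (sub_nonneg.2 hn'), mul_nonneg (sub_nonneg.2 hzp) (sub_nonneg.2 hn'),
      mul_nonneg (sub_nonneg.2 hn) (sub_nonneg.2 hzp'), mul_nonneg (sub_nonneg.2 hzq) (sub_nonneg.2 hn'),
      mul_nonneg (sub_nonneg.2 hn) (sub_nonneg.2 hzq'), mul_nonneg (sub_nonneg.2 hzp) (sub_nonneg.2 hzq'),
      mul_nonneg (sub_nonneg.2 hzq) (sub_nonneg.2 hzp')]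
  · -- `p ≤ A` for the product: `P P' + T T' ≤ Mₐ Mₐ' + Z Z'`
    nlinarith [mul_le_mul hpa hpa' (by linarith) (by linarith), mul_nonneg hz (sub_nonneg.2 hpa'),
      mul_nonneg (sub_nonneg.2 hpa) hz', mul_nonneg (sub_nonneg.2 hzp) (sub_nonneg.2 hta'),
      mul_nonneg (sub_nonneg.2 hta) (sub_nonneg.2 hzp'), mul_nonneg (sub_nonneg.2 hzp) (sub_nonneg.2 hzp'),
      mul_nonneg (sub_nonneg.2 hta) (sub_nonneg.2 hta'), mul_le_mul hzp hpa' (by linarith) hp,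
      mul_nonneg ht (sub_nonneg.2 hta'), mul_nonneg (sub_nonneg.2 hta) ht']
  · -- `q ≤ B` for the product: `Q Q' + T T' ≤ M_b M_b' + Z Z'`
    nlinarith [mul_le_mul hqb hqb' (by linarith) (by linarith), mul_nonneg hz (sub_nonneg.2 hqb'),
      mul_nonneg (sub_nonneg.2 hqb) hz', mul_nonneg (sub_nonneg.2 hzq) (sub_nonneg.2 htb'),
      mul_nonneg (sub_nonneg.2 htb) (sub_nonneg.2 hzq'), mul_nonneg (sub_nonneg.2 hzq) (sub_nonneg.2 hzq'),
      mul_nonneg (sub_nonneg.2 htb) (sub_nonneg.2 htb'), mul_le_mul hzq hqb' (by linarith) hq,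
      mul_nonneg ht (sub_nonneg.2 htb'), mul_nonneg (sub_nonneg.2 htb) ht']

/-- **`K_CF` is closed under finite products**: the coordinatewise product over a finite family of
six-tuples of `K_CF` is in `K_CF`. -/
theorem MemKCFProd.prod {ι : Type*} (s : Finset ι) (T P Q Z Ma Mb : ι → K)
    (h : ∀ i ∈ s, MemKCFProd (T i) (P i) (Q i) (Z i) (Ma i) (Mb i)) :
    MemKCFProd (∏ i ∈ s, T i) (∏ i ∈ s, P i) (∏ i ∈ s, Q i) (∏ i ∈ s, Z i) (∏ i ∈ s, Ma i)
      (∏ i ∈ s, Mb i) := by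
  classical
  induction s using Finset.induction_on with
  | empty => simpa using MemKCFProd.one (K := K)
  | insert i s hi ih =>
    simp only [Finset.prod_insert hi]
    exact (h i (Finset.mem_insert_self i s)).mul
      (ih fun j hj => h j (Finset.mem_insert_of_mem hj))

/-- **THEOREM PROD-CF for `k` generators** (mine-3, `MINE3-PRODUCT.md` §2b): for a finite family
of generators `(zᵢ, pᵢ, qᵢ, nᵢ, Aᵢ, Bᵢ) ∈ K_CF` with `tᵢ = zᵢ + pᵢ + qᵢ + nᵢ`, the products
`T = Π tᵢ`, `P = Π (zᵢ + pᵢ)`, `Q = Π (zᵢ + qᵢ)`, `Z = Π zᵢ`, `Mₐ = Π (tᵢ + Aᵢ)`, `M_b = Π (tᵢ + Bᵢ)`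
satisfy `3T + Z ≤ P + Q + Mₐ + M_b`, i.e. `N = T − P − Q + Z ≤ (Mₐ − T) + (M_b − T) = 𝒜 + ℬ`. -/
theorem prodCF_prod {ι : Type*} (s : Finset ι) (z p q n A B : ι → K)
    (h : ∀ i ∈ s, MemKCF (z i) (p i) (q i) (n i) (A i) (B i)) :
    3 * ∏ i ∈ s, (z i + p i + q i + n i) + ∏ i ∈ s, z i ≤
      ∏ i ∈ s, (z i + p i) + ∏ i ∈ s, (z i + q i) + ∏ i ∈ s, (z i + p i + q i + n i + A i) +
        ∏ i ∈ s, (z i + p i + q i + n i + B i) := by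
  refine (MemKCFProd.prod s (fun i => z i + p i + q i + n i) (fun i => z i + p i)
    (fun i => z i + q i) z (fun i => z i + p i + q i + n i + A i)
    (fun i => z i + p i + q i + n i + B i) fun i hi => ?_).cf
  obtain ⟨hz, hp, hq, hn, hA, hB, hpA, hqB, hnAB⟩ := h i hi
  exact ⟨hz, by linarith, by linarith, by linarith, by linarith, by linarith, by linarith,
    by linarith, by linarith⟩

end ProdCF

end PercRepro
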